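import Summits.Ventures.YMGap.Thresholds.OneLinkRemainderIdentity
import Summits.Ventures.YMGap.Thresholds.OneLinkRemainderSmooth
import Summits.Ventures.YMGap.Thresholds.OneLinkLevelTwoCovariance
import HarnessLib

/-!
# Venture YMGap — the one-link modulus beyond first order, part 13: the POINTWISE GRADIENT BOUND of the cubic remainder
# `Γ(c₃, c₃) ≤ P²` on `SU(N)`

HONEST FRAMING: venture file of the cell `pub-ymgap` (QuantumFields programme), strong-coupling LATTICE bookkeeping for `SU(N)`
lattice Yang–Mills; nothing about the continuum or the mass gap in the Clay sense.  Pure matrix calculus («F5», part 2b-iii, of the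
cell note `HOME/p2/ONE-LINK-HIERARCHY.md` §4 (4.6)); no measure, no number of record.

WHAT.  `c₃ = Γ(Re tr(·B), ψ₂)` is the cubic remainder of the second-order Poisson solution; its `L²(ν_B)` gradient norm carries the
only Bakry–Émery factor `1/(1/2 − ‖B‖_op)` of the second-order covariance bound (`cov_linear_le_levelTwo`).  Here, for `N ≥ 3`,
every `B, Δ`, every ambient direction `A` and every `g ∈ SU(N)`:
* `abs_matD_c3poly_le`: `|D_A c₃'(g)| ≤ P(g) ‖A‖_F` for the eight-term polynomial `c₃'` of `OneLinkRemainderIdentity` (term by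
  term: `OneLinkCubicWords`, `OneLinkRemainderWords`; smoothness: `OneLinkRemainderSmooth`), with
  `P = 4κ_w r²‖Δ‖_F + (2κ_w/N)(2r‖Δ‖_F|X| + ‖B‖_F|w|) + ½κ₁(2r‖B‖_F|z₂| + ‖Δ‖_F|w_BB|) + ½κ₁(2r‖Δ‖_F|z₁| + ‖B‖_F|w|)
       + ½(κ_t − c)‖B‖_F²‖Δ‖_F + ½κ₁‖B‖_F²‖Δ‖_F + (2κ_t/N)(‖B‖_F|X||z₂| + ‖Δ‖_F|X||z₁| + ‖B‖_F|z₁||z₂|)`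
  (`r = ‖B‖_op`, `z₁ = tr(gB)`, `z₂ = tr(gΔ)`, `X = Im z₁`, `w = tr(gΔgB)`, `w_BB = tr(gBgB)`, `κ₁ = κ_t + c`, `c = 1/(4N)`);
* `Gam_c3_le` (THE RESULT): `Γ(c₃, c₃)(g) ≤ P(g)²` — by `Gam_self_congr_su` (tangential derivatives see only the restriction) and the
  frame trick `sum_sq_apply_frame_le`.
The polynomial `P` is the `bound46` of the cell folder `HOME/p2/hier/alg_check.py` ((C9)/(C9b): `Γ(c₃,c₃) ≤ P²` checked numerically
on `SU(3…6)` incl. the adversarial `B = r·1`).  Integrated (`Minkowski`) it is the `‖∇c₃‖_{L²(ν)}` entry (4.6) of `K₂(N, r)`.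

References: cell note `HOME/p2/ONE-LINK-HIERARCHY.md` §3–§4; `HOME/p2/hier/LEAN-SPEC-REMAINING.md` F5.2b.
-/

noncomputable section

open scoped Matrix ComplexConjugate BigOperators
open Matrix Complex Finset
open Literature.MathematicalPhysics.QuantumFieldTheory
open Literature.MathematicalPhysics.QuantumFieldTheory.SUNBakryEmery

namespace Summit.Ventures.YMGap.OneLinkEigen

variable {N : ℕ}

section Calc

open scoped Matrix.Norms.Frobenius ContDiff Topology

/-! ### The pointwise derivative bound of the eight-term polynomial -/

/-- **`|D_A c₃'(g)| ≤ P(g) ‖A‖_F`** on `SU(N)`, `N ≥ 3`, every ambient direction `A` (see the module docstring for `P`). [folklore] -/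
theorem abs_matD_c3poly_le (hN : 3 ≤ N) (B Δ A : Matrix (Fin N) (Fin N) ℂ) (g : SUN N) :
    |matD A (fun Q : Matrix (Fin N) (Fin N) ℂ =>
      ((N : ℝ) ^ 2 / (4 * ((N : ℝ) ^ 2 - 4))) / 2 *
          ((Q * B * Q * Δ * Q * B).trace.re + (Q * B * Q * B * Q * Δ).trace.re)
        - ((N : ℝ) ^ 2 / (4 * ((N : ℝ) ^ 2 - 4))) / 2 *
          ((Q * (B * Bᴴ * Δ)).trace.re + (Q * (Δ * Bᴴ * B)).trace.re)
        + 2 * ((N : ℝ) ^ 2 / (4 * ((N : ℝ) ^ 2 - 4))) / N * (Q * B).trace.im * (Q * Δ * Q * B).trace.im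
        - 1 / 2 * ((Q * B * Q * B).trace *
            ((((N : ℝ) / (2 * ((N : ℝ) ^ 2 - 4)) : ℝ) : ℂ) * (Q * Δ).trace
              - ((1 / (4 * (N : ℝ)) : ℝ) : ℂ) * (starRingEnd ℂ) (Q * Δ).trace)).re
        - 1 / 2 * ((Q * Δ * Q * B).trace *
            ((((N : ℝ) / (2 * ((N : ℝ) ^ 2 - 4)) : ℝ) : ℂ) * (Q * B).trace
              - ((1 / (4 * (N : ℝ)) : ℝ) : ℂ) * (starRingEnd ℂ) (Q * B).trace)).re
        + 1 / 2 * ((Q * Δ).trace *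
            ((((N : ℝ) / (2 * ((N : ℝ) ^ 2 - 4)) : ℝ) : ℂ) * (B * Bᴴ).trace
              - ((1 / (4 * (N : ℝ)) : ℝ) : ℂ) * (starRingEnd ℂ) (B * Bᴴ).trace)).re
        + 1 / 2 * ((Q * B).trace *
            ((((N : ℝ) / (2 * ((N : ℝ) ^ 2 - 4)) : ℝ) : ℂ) * (Δ * Bᴴ).trace
              - ((1 / (4 * (N : ℝ)) : ℝ) : ℂ) * (starRingEnd ℂ) (Δ * Bᴴ).trace)).re
        - 2 * ((N : ℝ) / (2 * ((N : ℝ) ^ 2 - 4))) / N *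
          (Q * B).trace.im * ((Q * B).trace * (Q * Δ).trace).im) g| ≤
      (4 * ((N : ℝ) ^ 2 / (4 * ((N : ℝ) ^ 2 - 4))) * matrixOpNorm B ^ 2 * frobNorm Δ
        + 2 * ((N : ℝ) ^ 2 / (4 * ((N : ℝ) ^ 2 - 4))) / N *
          (2 * matrixOpNorm B * frobNorm Δ * |((g : Matrix (Fin N) (Fin N) ℂ) * B).trace.im|
            + frobNorm B * ‖((g : Matrix (Fin N) (Fin N) ℂ) * Δ * g * B).trace‖)
        + 1 / 2 * ((N : ℝ) / (2 * ((N : ℝ) ^ 2 - 4)) + 1 / (4 * (N : ℝ))) *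
          (2 * matrixOpNorm B * frobNorm B * ‖((g : Matrix (Fin N) (Fin N) ℂ) * Δ).trace‖
            + frobNorm Δ * ‖((g : Matrix (Fin N) (Fin N) ℂ) * B * g * B).trace‖)
        + 1 / 2 * ((N : ℝ) / (2 * ((N : ℝ) ^ 2 - 4)) + 1 / (4 * (N : ℝ))) *
          (2 * matrixOpNorm B * frobNorm Δ * ‖((g : Matrix (Fin N) (Fin N) ℂ) * B).trace‖
            + frobNorm B * ‖((g : Matrix (Fin N) (Fin N) ℂ) * Δ * g * B).trace‖)
        + 1 / 2 * ((N : ℝ) / (2 * ((N : ℝ) ^ 2 - 4)) - 1 / (4 * (N : ℝ))) * frobNorm B ^ 2 * frobNorm Δ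
        + 1 / 2 * ((N : ℝ) / (2 * ((N : ℝ) ^ 2 - 4)) + 1 / (4 * (N : ℝ))) * frobNorm B ^ 2 * frobNorm Δ
        + 2 * ((N : ℝ) / (2 * ((N : ℝ) ^ 2 - 4))) / N *
          (frobNorm B * |((g : Matrix (Fin N) (Fin N) ℂ) * B).trace.im| * ‖((g : Matrix (Fin N) (Fin N) ℂ) * Δ).trace‖
            + frobNorm Δ * |((g : Matrix (Fin N) (Fin N) ℂ) * B).trace.im| * ‖((g : Matrix (Fin N) (Fin N) ℂ) * B).trace‖
            + frobNorm B * ‖((g : Matrix (Fin N) (Fin N) ℂ) * B).trace‖ * ‖((g : Matrix (Fin N) (Fin N) ℂ) * Δ).trace‖))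
        * frobNorm A := by
  have hN0 : N ≠ 0 := by omega
  have h3 : (3 : ℝ) ≤ N := by exact_mod_cast hN
  have hN4 : (0 : ℝ) < (N : ℝ) ^ 2 - 4 := by nlinarith
  have hNpos : (0 : ℝ) < N := by linarith
  set κw : ℝ := (N : ℝ) ^ 2 / (4 * ((N : ℝ) ^ 2 - 4)) with hκw
  set κt : ℝ := (N : ℝ) / (2 * ((N : ℝ) ^ 2 - 4)) with hκt
  set c : ℝ := 1 / (4 * (N : ℝ)) with hc
  have hκw0 : 0 ≤ κw := by positivity
  have hκt0 : 0 ≤ κt := by positivity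
  have hc0 : 0 ≤ c := by positivity
  have hcκ : c ≤ κt := by
    rw [hc, hκt, div_le_div_iff₀ (by positivity) (by positivity)]
    nlinarith
  set Q : Matrix (Fin N) (Fin N) ℂ := (g : Matrix (Fin N) (Fin N) ℂ) with hQ
  -- the eight smooth cores
  have h1 := (contDiff_reTrCubic (N := N) B Δ B).add (contDiff_reTrCubic (N := N) B B Δ)
  have h2 := (contDiff_reTrMul (N := N) (B * Bᴴ * Δ)).add (contDiff_reTrMul (N := N) (Δ * Bᴴ * B))
  have h3' := (contDiff_imTrMul (N := N) B).mul (contDiff_imTrQuad (N := N) Δ B)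
  have h4 := contDiff_quad_eta (N := N) κt c B B Δ
  have h5 := contDiff_quad_eta (N := N) κt c Δ B B
  have h6 := contDiff_lin_const (N := N) Δ ((κt : ℂ) * (B * Bᴴ).trace - (c : ℂ) * (starRingEnd ℂ) (B * Bᴴ).trace)
  have h7 := contDiff_lin_const (N := N) B ((κt : ℂ) * (Δ * Bᴴ).trace - (c : ℂ) * (starRingEnd ℂ) (Δ * Bᴴ).trace)
  have h8 := contDiff_im_mul_imProd (N := N) B Δ
  have hG : (fun Q : Matrix (Fin N) (Fin N) ℂ =>
      κw / 2 * ((Q * B * Q * Δ * Q * B).trace.re + (Q * B * Q * B * Q * Δ).trace.re)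
        - κw / 2 * ((Q * (B * Bᴴ * Δ)).trace.re + (Q * (Δ * Bᴴ * B)).trace.re)
        + 2 * κw / N * (Q * B).trace.im * (Q * Δ * Q * B).trace.im
        - 1 / 2 * ((Q * B * Q * B).trace * ((κt : ℂ) * (Q * Δ).trace - (c : ℂ) * (starRingEnd ℂ) (Q * Δ).trace)).re
        - 1 / 2 * ((Q * Δ * Q * B).trace * ((κt : ℂ) * (Q * B).trace - (c : ℂ) * (starRingEnd ℂ) (Q * B).trace)).re
        + 1 / 2 * ((Q * Δ).trace * ((κt : ℂ) * (B * Bᴴ).trace - (c : ℂ) * (starRingEnd ℂ) (B * Bᴴ).trace)).re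
        + 1 / 2 * ((Q * B).trace * ((κt : ℂ) * (Δ * Bᴴ).trace - (c : ℂ) * (starRingEnd ℂ) (Δ * Bᴴ).trace)).re
        - 2 * κt / N * (Q * B).trace.im * ((Q * B).trace * (Q * Δ).trace).im) =
      fun Q : Matrix (Fin N) (Fin N) ℂ =>
        (κw / 2) * ((Q * B * Q * Δ * Q * B).trace.re + (Q * B * Q * B * Q * Δ).trace.re)
        + (-(κw / 2)) * ((Q * (B * Bᴴ * Δ)).trace.re + (Q * (Δ * Bᴴ * B)).trace.re)
        + (2 * κw / N) * ((Q * B).trace.im * (Q * Δ * Q * B).trace.im)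
        + (-(1 / 2)) * ((Q * B * Q * B).trace * ((κt : ℂ) * (Q * Δ).trace - (c : ℂ) * (starRingEnd ℂ) (Q * Δ).trace)).re
        + (-(1 / 2)) * ((Q * Δ * Q * B).trace * ((κt : ℂ) * (Q * B).trace - (c : ℂ) * (starRingEnd ℂ) (Q * B).trace)).re
        + (1 / 2) * ((Q * Δ).trace * ((κt : ℂ) * (B * Bᴴ).trace - (c : ℂ) * (starRingEnd ℂ) (B * Bᴴ).trace)).re
        + (1 / 2) * ((Q * B).trace * ((κt : ℂ) * (Δ * Bᴴ).trace - (c : ℂ) * (starRingEnd ℂ) (Δ * Bᴴ).trace)).re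
        + (-(2 * κt / N)) * ((Q * B).trace.im * ((Q * B).trace * (Q * Δ).trace).im) := by
    funext Q; ring
  have g1 : ContDiff ℝ ∞ fun Q : Matrix (Fin N) (Fin N) ℂ =>
      (κw / 2) * ((Q * B * Q * Δ * Q * B).trace.re + (Q * B * Q * B * Q * Δ).trace.re) := contDiff_const.mul h1
  have g2 : ContDiff ℝ ∞ fun Q : Matrix (Fin N) (Fin N) ℂ =>
      (-(κw / 2)) * ((Q * (B * Bᴴ * Δ)).trace.re + (Q * (Δ * Bᴴ * B)).trace.re) := contDiff_const.mul h2
  have g3 : ContDiff ℝ ∞ fun Q : Matrix (Fin N) (Fin N) ℂ =>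
      (2 * κw / N) * ((Q * B).trace.im * (Q * Δ * Q * B).trace.im) := contDiff_const.mul h3'
  have g4 : ContDiff ℝ ∞ fun Q : Matrix (Fin N) (Fin N) ℂ => (-(1 / 2)) *
      ((Q * B * Q * B).trace * ((κt : ℂ) * (Q * Δ).trace - (c : ℂ) * (starRingEnd ℂ) (Q * Δ).trace)).re := contDiff_const.mul h4
  have g5 : ContDiff ℝ ∞ fun Q : Matrix (Fin N) (Fin N) ℂ => (-(1 / 2)) *
      ((Q * Δ * Q * B).trace * ((κt : ℂ) * (Q * B).trace - (c : ℂ) * (starRingEnd ℂ) (Q * B).trace)).re := contDiff_const.mul h5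
  have g6 : ContDiff ℝ ∞ fun Q : Matrix (Fin N) (Fin N) ℂ => (1 / 2) *
      ((Q * Δ).trace * ((κt : ℂ) * (B * Bᴴ).trace - (c : ℂ) * (starRingEnd ℂ) (B * Bᴴ).trace)).re := contDiff_const.mul h6
  have g7 : ContDiff ℝ ∞ fun Q : Matrix (Fin N) (Fin N) ℂ => (1 / 2) *
      ((Q * B).trace * ((κt : ℂ) * (Δ * Bᴴ).trace - (c : ℂ) * (starRingEnd ℂ) (Δ * Bᴴ).trace)).re := contDiff_const.mul h7
  have g8 : ContDiff ℝ ∞ fun Q : Matrix (Fin N) (Fin N) ℂ =>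
      (-(2 * κt / N)) * ((Q * B).trace.im * ((Q * B).trace * (Q * Δ).trace).im) := contDiff_const.mul h8
  have s2 := g1.add g2
  have s3 := s2.add g3
  have s4 := s3.add g4
  have s5 := s4.add g5
  have s6 := s5.add g6
  have s7 := s6.add g7
  rw [hG, matD_fun_add s7 g8, matD_fun_add s6 g7, matD_fun_add s5 g6, matD_fun_add s4 g5, matD_fun_add s3 g4,
    matD_fun_add s2 g3, matD_fun_add g1 g2]
  simp only []
  rw [matD_const_mul h1, matD_const_mul h2, matD_const_mul h3', matD_const_mul h4, matD_const_mul h5, matD_const_mul h6,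
    matD_const_mul h7, matD_const_mul h8]
  simp only []
  -- the eight term bounds
  have hA := frobNorm_nonneg A
  have hB0 := matrixOpNorm_nonneg B
  have hBF := frobNorm_nonneg B
  have hΔ := frobNorm_nonneg Δ
  have e1 : |matD A (fun Q : Matrix (Fin N) (Fin N) ℂ =>
      (Q * B * Q * Δ * Q * B).trace.re + (Q * B * Q * B * Q * Δ).trace.re) Q| ≤
      6 * matrixOpNorm B ^ 2 * frobNorm Δ * frobNorm A := by
    rw [matD_fun_add (contDiff_reTrCubic B Δ B) (contDiff_reTrCubic B B Δ)]
    have t1 := abs_matD_reTrCubic_BDB_le A B Δ g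
    have t2 := abs_matD_reTrCubic_BBD_le A B Δ g
    refine (abs_add_le _ _).trans ?_
    rw [← hQ] at t1 t2
    linarith
  have e2 := abs_matD_linB_le A B Δ g
  have e3 := abs_matD_im_mul_imQuad_le A B Δ g
  have e4 : |matD A (fun Q : Matrix (Fin N) (Fin N) ℂ =>
      ((Q * B * Q * B).trace * ((κt : ℂ) * (Q * Δ).trace - (c : ℂ) * (starRingEnd ℂ) (Q * Δ).trace)).re) Q| ≤
      (κt + c) * (2 * matrixOpNorm B * frobNorm B * ‖(Q * Δ).trace‖ + ‖(Q * B * Q * B).trace‖ * frobNorm Δ) * frobNorm A := by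
    refine (abs_matD_quad_eta_le hκt0 hc0 A B B Δ g).trans ?_
    rw [← hQ]
    have hb := frobNorm_BgM_le B B g
    rw [← hQ] at hb
    have hκc : 0 ≤ κt + c := add_nonneg hκt0 hc0
    have : (frobNorm (B * Q * B) + frobNorm (B * Q * B)) * ‖(Q * Δ).trace‖ ≤
        2 * matrixOpNorm B * frobNorm B * ‖(Q * Δ).trace‖ := by nlinarith [norm_nonneg (Q * Δ).trace]
    exact mul_le_mul_of_nonneg_right (mul_le_mul_of_nonneg_left (by linarith) hκc) hA
  have e5 : |matD A (fun Q : Matrix (Fin N) (Fin N) ℂ =>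
      ((Q * Δ * Q * B).trace * ((κt : ℂ) * (Q * B).trace - (c : ℂ) * (starRingEnd ℂ) (Q * B).trace)).re) Q| ≤
      (κt + c) * (2 * matrixOpNorm B * frobNorm Δ * ‖(Q * B).trace‖ + ‖(Q * Δ * Q * B).trace‖ * frobNorm B) * frobNorm A := by
    refine (abs_matD_quad_eta_le hκt0 hc0 A Δ B B g).trans ?_
    rw [← hQ]
    have hb1 := frobNorm_MgB_le Δ B g
    have hb2 := frobNorm_BgM_le B Δ g
    rw [← hQ] at hb1 hb2
    have hκc : 0 ≤ κt + c := add_nonneg hκt0 hc0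
    have : (frobNorm (Δ * Q * B) + frobNorm (B * Q * Δ)) * ‖(Q * B).trace‖ ≤
        2 * matrixOpNorm B * frobNorm Δ * ‖(Q * B).trace‖ := by nlinarith [norm_nonneg (Q * B).trace]
    exact mul_le_mul_of_nonneg_right (mul_le_mul_of_nonneg_left (by linarith) hκc) hA
  have e6 : |matD A (fun Q : Matrix (Fin N) (Fin N) ℂ =>
      ((Q * Δ).trace * ((κt : ℂ) * (B * Bᴴ).trace - (c : ℂ) * (starRingEnd ℂ) (B * Bᴴ).trace)).re) Q| ≤
      frobNorm Δ * ((κt - c) * frobNorm B ^ 2) * frobNorm A := by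
    have h := abs_matD_lin_const_le A Δ ((κt : ℂ) * (B * Bᴴ).trace - (c : ℂ) * (starRingEnd ℂ) (B * Bᴴ).trace) g
    rwa [norm_eta_frob B hcκ, ← hQ] at h
  have e7 : |matD A (fun Q : Matrix (Fin N) (Fin N) ℂ =>
      ((Q * B).trace * ((κt : ℂ) * (Δ * Bᴴ).trace - (c : ℂ) * (starRingEnd ℂ) (Δ * Bᴴ).trace)).re) Q| ≤
      frobNorm B * ((κt + c) * (frobNorm Δ * frobNorm B)) * frobNorm A := by
    refine (abs_matD_lin_const_le A B _ g).trans ?_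
    have hτ : ‖(Δ * Bᴴ).trace‖ ≤ frobNorm Δ * frobNorm B := by
      have h := norm_trace_mul_le Δ Bᴴ; rwa [frobNorm_conjTranspose] at h
    have hη := (norm_kappa_sub_conj_le hκt0 hc0 (Δ * Bᴴ).trace).trans
      (mul_le_mul_of_nonneg_left hτ (add_nonneg hκt0 hc0))
    exact mul_le_mul_of_nonneg_right (mul_le_mul_of_nonneg_left hη hBF) hA
  have e8 := abs_matD_im_mul_imProd_le A B Δ g
  rw [← hQ] at e2 e3 e8
  -- assemble
  have X0 := abs_nonneg (Q * B).trace.im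
  have z10 := norm_nonneg (Q * B).trace
  have z20 := norm_nonneg (Q * Δ).trace
  have w0 := norm_nonneg (Q * Δ * Q * B).trace
  have wBB0 := norm_nonneg (Q * B * Q * B).trace
  calc _ ≤ |κw / 2 * matD A (fun Q : Matrix (Fin N) (Fin N) ℂ =>
              (Q * B * Q * Δ * Q * B).trace.re + (Q * B * Q * B * Q * Δ).trace.re) Q|
          + |(-(κw / 2)) * matD A (fun Q : Matrix (Fin N) (Fin N) ℂ =>
              (Q * (B * Bᴴ * Δ)).trace.re + (Q * (Δ * Bᴴ * B)).trace.re) Q|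
          + |2 * κw / N * matD A (fun Q : Matrix (Fin N) (Fin N) ℂ => (Q * B).trace.im * (Q * Δ * Q * B).trace.im) Q|
          + |(-(1 / 2)) * matD A (fun Q : Matrix (Fin N) (Fin N) ℂ =>
              ((Q * B * Q * B).trace * ((κt : ℂ) * (Q * Δ).trace - (c : ℂ) * (starRingEnd ℂ) (Q * Δ).trace)).re) Q|
          + |(-(1 / 2)) * matD A (fun Q : Matrix (Fin N) (Fin N) ℂ =>
              ((Q * Δ * Q * B).trace * ((κt : ℂ) * (Q * B).trace - (c : ℂ) * (starRingEnd ℂ) (Q * B).trace)).re) Q|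
          + |1 / 2 * matD A (fun Q : Matrix (Fin N) (Fin N) ℂ =>
              ((Q * Δ).trace * ((κt : ℂ) * (B * Bᴴ).trace - (c : ℂ) * (starRingEnd ℂ) (B * Bᴴ).trace)).re) Q|
          + |1 / 2 * matD A (fun Q : Matrix (Fin N) (Fin N) ℂ =>
              ((Q * B).trace * ((κt : ℂ) * (Δ * Bᴴ).trace - (c : ℂ) * (starRingEnd ℂ) (Δ * Bᴴ).trace)).re) Q|
          + |(-(2 * κt / N)) * matD A (fun Q : Matrix (Fin N) (Fin N) ℂ =>
              (Q * B).trace.im * ((Q * B).trace * (Q * Δ).trace).im) Q| := by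
        refine (abs_add_le _ _).trans ?_
        gcongr
        refine (abs_add_le _ _).trans ?_
        gcongr
        refine (abs_add_le _ _).trans ?_
        gcongr
        refine (abs_add_le _ _).trans ?_
        gcongr
        refine (abs_add_le _ _).trans ?_
        gcongr
        refine (abs_add_le _ _).trans ?_
        gcongr
        exact abs_add_le _ _
    _ = κw / 2 * |matD A (fun Q : Matrix (Fin N) (Fin N) ℂ =>
              (Q * B * Q * Δ * Q * B).trace.re + (Q * B * Q * B * Q * Δ).trace.re) Q|
          + κw / 2 * |matD A (fun Q : Matrix (Fin N) (Fin N) ℂ =>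
              (Q * (B * Bᴴ * Δ)).trace.re + (Q * (Δ * Bᴴ * B)).trace.re) Q|
          + 2 * κw / N * |matD A (fun Q : Matrix (Fin N) (Fin N) ℂ => (Q * B).trace.im * (Q * Δ * Q * B).trace.im) Q|
          + 1 / 2 * |matD A (fun Q : Matrix (Fin N) (Fin N) ℂ =>
              ((Q * B * Q * B).trace * ((κt : ℂ) * (Q * Δ).trace - (c : ℂ) * (starRingEnd ℂ) (Q * Δ).trace)).re) Q|
          + 1 / 2 * |matD A (fun Q : Matrix (Fin N) (Fin N) ℂ =>
              ((Q * Δ * Q * B).trace * ((κt : ℂ) * (Q * B).trace - (c : ℂ) * (starRingEnd ℂ) (Q * B).trace)).re) Q|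
          + 1 / 2 * |matD A (fun Q : Matrix (Fin N) (Fin N) ℂ =>
              ((Q * Δ).trace * ((κt : ℂ) * (B * Bᴴ).trace - (c : ℂ) * (starRingEnd ℂ) (B * Bᴴ).trace)).re) Q|
          + 1 / 2 * |matD A (fun Q : Matrix (Fin N) (Fin N) ℂ =>
              ((Q * B).trace * ((κt : ℂ) * (Δ * Bᴴ).trace - (c : ℂ) * (starRingEnd ℂ) (Δ * Bᴴ).trace)).re) Q|
          + 2 * κt / N * |matD A (fun Q : Matrix (Fin N) (Fin N) ℂ =>
              (Q * B).trace.im * ((Q * B).trace * (Q * Δ).trace).im) Q| := by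
        simp only [abs_mul, abs_neg, abs_of_nonneg (by positivity : (0 : ℝ) ≤ κw / 2),
          abs_of_nonneg (by positivity : (0 : ℝ) ≤ 2 * κw / N), abs_of_nonneg (by norm_num : (0 : ℝ) ≤ 1 / 2),
          abs_of_nonneg (by positivity : (0 : ℝ) ≤ 2 * κt / N)]
    _ ≤ κw / 2 * (6 * matrixOpNorm B ^ 2 * frobNorm Δ * frobNorm A)
          + κw / 2 * (2 * matrixOpNorm B ^ 2 * frobNorm Δ * frobNorm A)
          + 2 * κw / N * ((2 * matrixOpNorm B * frobNorm Δ * |(Q * B).trace.im|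
              + frobNorm B * ‖(Q * Δ * Q * B).trace‖) * frobNorm A)
          + 1 / 2 * ((κt + c) * (2 * matrixOpNorm B * frobNorm B * ‖(Q * Δ).trace‖ + ‖(Q * B * Q * B).trace‖ * frobNorm Δ)
              * frobNorm A)
          + 1 / 2 * ((κt + c) * (2 * matrixOpNorm B * frobNorm Δ * ‖(Q * B).trace‖ + ‖(Q * Δ * Q * B).trace‖ * frobNorm B)
              * frobNorm A)
          + 1 / 2 * (frobNorm Δ * ((κt - c) * frobNorm B ^ 2) * frobNorm A)
          + 1 / 2 * (frobNorm B * ((κt + c) * (frobNorm Δ * frobNorm B)) * frobNorm A)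
          + 2 * κt / N * ((|(Q * B).trace.im| * (frobNorm B * ‖(Q * Δ).trace‖ + frobNorm Δ * ‖(Q * B).trace‖)
              + frobNorm B * ‖(Q * B).trace‖ * ‖(Q * Δ).trace‖) * frobNorm A) := by
        gcongr
    _ = _ := by ring

/-! ### The gradient of the cubic remainder -/

/-- **`Γ(c₃, c₃)(g) ≤ P(g)²` on `SU(N)`** for the cubic remainder `c₃ = Γ(Re tr(·B), ψ₂)` of the second-order Poisson solution,
`N ≥ 3`, every `B, Δ` (see the module docstring for `P`; this is (4.6) of the cell note, pointwise). [folklore] -/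
theorem Gam_c3_le (hN : 3 ≤ N) (B Δ : Matrix (Fin N) (Fin N) ℂ) (g : SUN N) :
    Gam (Gam (pot 1 B) fun Q : Matrix (Fin N) (Fin N) ℂ =>
          -((N : ℝ) ^ 2 / (4 * ((N : ℝ) ^ 2 - 4))) * (Q * Δ * Q * B).trace.re
            + ((N : ℝ) / (2 * ((N : ℝ) ^ 2 - 4))) * ((Q * B).trace * (Q * Δ).trace).re
            - (1 / (4 * (N : ℝ))) * ((Q * B).trace * (starRingEnd ℂ) (Q * Δ).trace).re)
        (Gam (pot 1 B) fun Q : Matrix (Fin N) (Fin N) ℂ =>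
          -((N : ℝ) ^ 2 / (4 * ((N : ℝ) ^ 2 - 4))) * (Q * Δ * Q * B).trace.re
            + ((N : ℝ) / (2 * ((N : ℝ) ^ 2 - 4))) * ((Q * B).trace * (Q * Δ).trace).re
            - (1 / (4 * (N : ℝ))) * ((Q * B).trace * (starRingEnd ℂ) (Q * Δ).trace).re) g ≤
      (4 * ((N : ℝ) ^ 2 / (4 * ((N : ℝ) ^ 2 - 4))) * matrixOpNorm B ^ 2 * frobNorm Δ
        + 2 * ((N : ℝ) ^ 2 / (4 * ((N : ℝ) ^ 2 - 4))) / N *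
          (2 * matrixOpNorm B * frobNorm Δ * |((g : Matrix (Fin N) (Fin N) ℂ) * B).trace.im|
            + frobNorm B * ‖((g : Matrix (Fin N) (Fin N) ℂ) * Δ * g * B).trace‖)
        + 1 / 2 * ((N : ℝ) / (2 * ((N : ℝ) ^ 2 - 4)) + 1 / (4 * (N : ℝ))) *
          (2 * matrixOpNorm B * frobNorm B * ‖((g : Matrix (Fin N) (Fin N) ℂ) * Δ).trace‖
            + frobNorm Δ * ‖((g : Matrix (Fin N) (Fin N) ℂ) * B * g * B).trace‖)
        + 1 / 2 * ((N : ℝ) / (2 * ((N : ℝ) ^ 2 - 4)) + 1 / (4 * (N : ℝ))) *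
          (2 * matrixOpNorm B * frobNorm Δ * ‖((g : Matrix (Fin N) (Fin N) ℂ) * B).trace‖
            + frobNorm B * ‖((g : Matrix (Fin N) (Fin N) ℂ) * Δ * g * B).trace‖)
        + 1 / 2 * ((N : ℝ) / (2 * ((N : ℝ) ^ 2 - 4)) - 1 / (4 * (N : ℝ))) * frobNorm B ^ 2 * frobNorm Δ
        + 1 / 2 * ((N : ℝ) / (2 * ((N : ℝ) ^ 2 - 4)) + 1 / (4 * (N : ℝ))) * frobNorm B ^ 2 * frobNorm Δ
        + 2 * ((N : ℝ) / (2 * ((N : ℝ) ^ 2 - 4))) / N *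
          (frobNorm B * |((g : Matrix (Fin N) (Fin N) ℂ) * B).trace.im| * ‖((g : Matrix (Fin N) (Fin N) ℂ) * Δ).trace‖
            + frobNorm Δ * |((g : Matrix (Fin N) (Fin N) ℂ) * B).trace.im| * ‖((g : Matrix (Fin N) (Fin N) ℂ) * B).trace‖
            + frobNorm B * ‖((g : Matrix (Fin N) (Fin N) ℂ) * B).trace‖ * ‖((g : Matrix (Fin N) (Fin N) ℂ) * Δ).trace‖)) ^ 2 := by
  have hN0 : N ≠ 0 := by omega
  have hc3 := contDiff_Gam (contDiff_pot (N := N) 1 B) (contDiff_psiTwo N B Δ)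
  rw [Gam_self_congr_su hN0 hc3 (contDiff_c3poly N B Δ) (fun g' => gam_potB_psiTwo_eq hN B Δ g') g, Gam_self_eq_sum_sq]
  exact sum_sq_apply_frame_le hN0 (dirFun _ _) fun A => abs_matD_c3poly_le hN B Δ A g

end Calc

end Summit.Ventures.YMGap.OneLinkEigen
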